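import Mathlib
import HarnessLib
import Literature.Analysis.FluidPDE.VectorCalculus
import Literature.Analysis.FluidPDE.NSBoundedSpatialHolder
import Literature.Analysis.FluidPDE.VanishingVerticalVorticityPotentials
import Summits.NavierStokesRegularity.NavierStokesRegularity.Theorems.LocalSineTubeDoorProfileAlignedWindowRigidityAncient
import Summits.NavierStokesRegularity.NavierStokesRegularity.Theorems.PoloidalWindowDoorPoloidalWindowRigidityClebsch

/-!
# Route `PoloidalWindowDoor` (staged, nsreg-p1), crux `PoloidalWindowRigidity` (K2) — the Bernoulli potential of a
# poloidal profile: the frozen constraint integrates to `∇_h B = v₂ ∇_h ψ`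

Cell ns-regularity-ideate, seat p7 (lead on K2; route-directed support for the open stub `stub_nonflatLiouville`,
to be landed `--supports <PoloidalWindowRigidity item>` once the route is born), third of the Clebsch files
(`…Clebsch`: slice potentials, (E1), frozen bracket; `…ClebschVorticity`: (E2)).

* GENERIC (`section Generic`): for smooth scalars `g, ψ` on `ℝ³` the horizontal field `W = g ∇_h ψ` has vertical
  curl `(curl W)₂ = ∂₀g ∂₁ψ − ∂₁g ∂₀ψ` (`curl_weightedHorizGrad_two`), so if the planar Poisson bracket vanishes
  then `W` is a horizontal gradient, `∇_h B = g ∇_h ψ` with `B` smooth (`exists_potential_of_bracket_eq_zero`, by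
  the tree's planar Poincaré lemma with parameter `VerticalVorticityFree.fderiv_linePotential_single`).
* CLASS (`section Profile`): under EXACTLY the hypotheses of `stub_nonflatLiouville`, for every slice `s < 0`
  there are smooth `φ, ψ, B` with `v s = ∇φ + ψ e₂`, `curl (v s) = ∇ψ × e₂`, (E1), the frozen bracket, and
  **`∇_h B = v₂ ∇_h ψ`** (`exists_bernoulli_slice`) — the kernel form of the first step of nsreg-p1's
  "generic branch" analysis (`B = β(ψ; x₂, t)`, `v₂ = ∂β/∂ψ`; ROUND-8 §8, R9-PREP §(1)). With (E2) one gets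
  `∇_h(∂ₜψ + v·∇ψ − Δψ − v₂∂₂ψ + ∂₂B) = 0`, i.e. the ψ-equation `∂ₜψ + v·∇ψ − Δψ = v₂∂₂ψ − ∂₂B + c(x₂,t)` of
  the census (HOME/ns-regularity-ideate-p7/CENSUS-K2G.md §5) — not formalised here.

WHAT THIS IS NOT: not a claim about Navier–Stokes regularity and not a proof of K2 — kernel bookkeeping for a
STAGED door route's open stub (bears_on LADDER-NS N0, rung N0-LocalTubeDoorPoloidal).
-/

noncomputable section

-- the summit and its single sub-problem share the name (CONVENTIONS §1), as in every Theorems file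
set_option linter.dupNamespace false

namespace Summit.NavierStokesRegularity.NavierStokesRegularity.Theorems.PoloidalWindowDoorPoloidalWindowRigidityClebschBernoulli

open Set Function
open scoped RealInnerProductSpace InnerProductSpace Laplacian ContDiff
open Literature.Analysis Literature.Analysis.FluidPDE
open Literature.Analysis.FluidPDE.VerticalVorticityFree

/-! ### Generic: a horizontal field `g ∇_h ψ` with `{ψ, g}_h = 0` is a horizontal gradient -/

section Generic

variable {g ψ : EuclideanSpace ℝ (Fin 3) → ℝ}

/-- The horizontal field `W = (g ∂₀ψ) e₀ + (g ∂₁ψ) e₁` built from two scalars. Coordinates. -/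
theorem weightedHorizGrad_apply (y : EuclideanSpace ℝ (Fin 3)) :
    ((g y * fderiv ℝ ψ y (EuclideanSpace.single 0 1)) • (EuclideanSpace.single (0 : Fin 3) (1 : ℝ)) +
        (g y * fderiv ℝ ψ y (EuclideanSpace.single 1 1)) • (EuclideanSpace.single (1 : Fin 3) (1 : ℝ))) 0 =
      g y * fderiv ℝ ψ y (EuclideanSpace.single 0 1) ∧
    ((g y * fderiv ℝ ψ y (EuclideanSpace.single 0 1)) • (EuclideanSpace.single (0 : Fin 3) (1 : ℝ)) +
        (g y * fderiv ℝ ψ y (EuclideanSpace.single 1 1)) • (EuclideanSpace.single (1 : Fin 3) (1 : ℝ))) 1 =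
      g y * fderiv ℝ ψ y (EuclideanSpace.single 1 1) ∧
    ((g y * fderiv ℝ ψ y (EuclideanSpace.single 0 1)) • (EuclideanSpace.single (0 : Fin 3) (1 : ℝ)) +
        (g y * fderiv ℝ ψ y (EuclideanSpace.single 1 1)) • (EuclideanSpace.single (1 : Fin 3) (1 : ℝ))) 2 = 0 := by
  refine ⟨?_, ?_, ?_⟩ <;> simp

/-- `W` is smooth for smooth `g, ψ`. -/
theorem contDiff_weightedHorizGrad (hg : ContDiff ℝ ∞ g) (hψ : ContDiff ℝ ∞ ψ) :
    ContDiff ℝ ∞ fun y : EuclideanSpace ℝ (Fin 3) =>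
      (g y * fderiv ℝ ψ y (EuclideanSpace.single 0 1)) • (EuclideanSpace.single (0 : Fin 3) (1 : ℝ)) +
        (g y * fderiv ℝ ψ y (EuclideanSpace.single 1 1)) • (EuclideanSpace.single (1 : Fin 3) (1 : ℝ)) := by
  have hd : ∀ u : EuclideanSpace ℝ (Fin 3), ContDiff ℝ ∞ fun y => fderiv ℝ ψ y u := fun u =>
    (hψ.fderiv_right (m := ∞) le_rfl).clm_apply contDiff_const
  exact ((hg.mul (hd _)).smul contDiff_const).add ((hg.mul (hd _)).smul contDiff_const)

/-- **The vertical curl of `W = g ∇_h ψ` is the planar Poisson bracket**: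
`(curl W)₂ = ∂₀g ∂₁ψ − ∂₁g ∂₀ψ` (mixed partials of `ψ` cancel). -/
theorem curl_weightedHorizGrad_two (hg : ContDiff ℝ ∞ g) (hψ : ContDiff ℝ ∞ ψ) (y : EuclideanSpace ℝ (Fin 3)) :
    curl (fun y : EuclideanSpace ℝ (Fin 3) =>
      (g y * fderiv ℝ ψ y (EuclideanSpace.single 0 1)) • (EuclideanSpace.single (0 : Fin 3) (1 : ℝ)) +
        (g y * fderiv ℝ ψ y (EuclideanSpace.single 1 1)) • (EuclideanSpace.single (1 : Fin 3) (1 : ℝ))) y 2 =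
      fderiv ℝ g y (EuclideanSpace.single 0 1) * fderiv ℝ ψ y (EuclideanSpace.single 1 1) -
        fderiv ℝ g y (EuclideanSpace.single 1 1) * fderiv ℝ ψ y (EuclideanSpace.single 0 1) := by
  set W : EuclideanSpace ℝ (Fin 3) → EuclideanSpace ℝ (Fin 3) := fun y =>
    (g y * fderiv ℝ ψ y (EuclideanSpace.single 0 1)) • (EuclideanSpace.single (0 : Fin 3) (1 : ℝ)) +
      (g y * fderiv ℝ ψ y (EuclideanSpace.single 1 1)) • (EuclideanSpace.single (1 : Fin 3) (1 : ℝ)) with hW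
  have hWs : ContDiff ℝ ∞ W := contDiff_weightedHorizGrad hg hψ
  have hd : ∀ u : EuclideanSpace ℝ (Fin 3), ContDiff ℝ ∞ fun y => fderiv ℝ ψ y u := fun u =>
    (hψ.fderiv_right (m := ∞) le_rfl).clm_apply contDiff_const
  have hW0 : (fun y => W y 0) = fun y => g y * fderiv ℝ ψ y (EuclideanSpace.single 0 1) :=
    funext fun y => (weightedHorizGrad_apply y).1
  have hW1 : (fun y => W y 1) = fun y => g y * fderiv ℝ ψ y (EuclideanSpace.single 1 1) :=
    funext fun y => (weightedHorizGrad_apply y).2.1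
  have hc : curl W y 2 = fderiv ℝ W y (EuclideanSpace.single 0 1) 1 - fderiv ℝ W y (EuclideanSpace.single 1 1) 0 := by
    simp [curl]
  have hgd : DifferentiableAt ℝ g y := (hg.differentiable (by simp)) y
  have hdd : ∀ u, DifferentiableAt ℝ (fun y => fderiv ℝ ψ y u) y := fun u => ((hd u).differentiable (by simp)) y
  rw [hc, ← fderiv_apply_coord hWs y _ 1, ← fderiv_apply_coord hWs y _ 0, hW1, hW0,
    fderiv_fun_mul hgd (hdd _), fderiv_fun_mul hgd (hdd _)]
  simp only [_root_.add_apply, _root_.smul_apply, smul_eq_mul]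
  rw [SerrinBoundedHolder.fderiv_fderiv_apply_comm (hψ.of_le (by norm_cast)) y
    (EuclideanSpace.single 1 1) (EuclideanSpace.single 0 1)]
  ring

/-- **Integration of the frozen constraint.** If `g, ψ` are smooth with vanishing planar Poisson bracket
`∂₁ψ ∂₀g − ∂₀ψ ∂₁g = 0` everywhere, then `g ∇_h ψ` is a horizontal gradient: there is a smooth `B` with
`∂₀B = g ∂₀ψ`, `∂₁B = g ∂₁ψ` (the horizontal line potential of `W = g∇_hψ`, tree
`VerticalVorticityFree.fderiv_linePotential_single`). -/
theorem exists_potential_of_bracket_eq_zero (hg : ContDiff ℝ ∞ g) (hψ : ContDiff ℝ ∞ ψ)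
    (hbr : ∀ y, fderiv ℝ ψ y (EuclideanSpace.single 1 1) * fderiv ℝ g y (EuclideanSpace.single 0 1) -
      fderiv ℝ ψ y (EuclideanSpace.single 0 1) * fderiv ℝ g y (EuclideanSpace.single 1 1) = 0) :
    ∃ B : EuclideanSpace ℝ (Fin 3) → ℝ, ContDiff ℝ ∞ B ∧
      (∀ y, fderiv ℝ B y (EuclideanSpace.single 0 1) = g y * fderiv ℝ ψ y (EuclideanSpace.single 0 1)) ∧
      (∀ y, fderiv ℝ B y (EuclideanSpace.single 1 1) = g y * fderiv ℝ ψ y (EuclideanSpace.single 1 1)) := by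
  set W : EuclideanSpace ℝ (Fin 3) → EuclideanSpace ℝ (Fin 3) := fun y =>
    (g y * fderiv ℝ ψ y (EuclideanSpace.single 0 1)) • (EuclideanSpace.single (0 : Fin 3) (1 : ℝ)) +
      (g y * fderiv ℝ ψ y (EuclideanSpace.single 1 1)) • (EuclideanSpace.single (1 : Fin 3) (1 : ℝ)) with hW
  have hWs : ContDiff ℝ ∞ W := contDiff_weightedHorizGrad hg hψ
  have hc2 : ∀ y, curl W y 2 = 0 := fun y => by
    rw [hW, curl_weightedHorizGrad_two hg hψ y]
    linarith [hbr y]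
  refine ⟨fun x => ∫ σ in (0 : ℝ)..1, ⟪W (σ • (x - x 2 • (EuclideanSpace.single (2 : Fin 3) (1 : ℝ))) +
      x 2 • (EuclideanSpace.single (2 : Fin 3) (1 : ℝ))), x - x 2 • (EuclideanSpace.single (2 : Fin 3) (1 : ℝ))⟫_ℝ,
    contDiff_linePotential hWs, fun y => ?_, fun y => ?_⟩
  · rw [fderiv_linePotential_single hWs hc2 y (Or.inl rfl)]
    exact (weightedHorizGrad_apply y).1
  · rw [fderiv_linePotential_single hWs hc2 y (Or.inr rfl)]
    exact (weightedHorizGrad_apply y).2.1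

/-- **Differentiating `∇_h B = g ∇_h ψ` across the planes.** If `∂₀B = g ∂₀ψ` and `∂₁B = g ∂₁ψ` everywhere
(`g, ψ, B` smooth), then for `i = 0, 1`: `∂ᵢ(g ∂₂ψ − ∂₂B) = ∂₂ψ ∂ᵢg − ∂₂g ∂ᵢψ` (the mixed partials of `ψ` and of `B`
cancel). With `g = v₂` and (E2) this is the ψ-equation `∇_h(∂ₜψ + v·∇ψ − Δψ − v₂∂₂ψ + ∂₂B) = 0`. -/
theorem fderiv_weight_mul_sub_apply (hg : ContDiff ℝ ∞ g) (hψ : ContDiff ℝ ∞ ψ) {B : EuclideanSpace ℝ (Fin 3) → ℝ}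
    (hB : ContDiff ℝ ∞ B)
    (hB0 : ∀ y, fderiv ℝ B y (EuclideanSpace.single 0 1) = g y * fderiv ℝ ψ y (EuclideanSpace.single 0 1))
    (hB1 : ∀ y, fderiv ℝ B y (EuclideanSpace.single 1 1) = g y * fderiv ℝ ψ y (EuclideanSpace.single 1 1))
    (y : EuclideanSpace ℝ (Fin 3)) {i : Fin 3} (hi : i = 0 ∨ i = 1) :
    fderiv ℝ (fun z => g z * fderiv ℝ ψ z (EuclideanSpace.single 2 1) - fderiv ℝ B z (EuclideanSpace.single 2 1)) y
        (EuclideanSpace.single i 1) =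
      fderiv ℝ ψ y (EuclideanSpace.single 2 1) * fderiv ℝ g y (EuclideanSpace.single i 1) -
        fderiv ℝ g y (EuclideanSpace.single 2 1) * fderiv ℝ ψ y (EuclideanSpace.single i 1) := by
  have hd : ∀ u : EuclideanSpace ℝ (Fin 3), ContDiff ℝ ∞ fun y => fderiv ℝ ψ y u := fun u =>
    (hψ.fderiv_right (m := ∞) le_rfl).clm_apply contDiff_const
  have hdB : ∀ u : EuclideanSpace ℝ (Fin 3), ContDiff ℝ ∞ fun y => fderiv ℝ B y u := fun u =>
    (hB.fderiv_right (m := ∞) le_rfl).clm_apply contDiff_const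
  have hgd : DifferentiableAt ℝ g y := (hg.differentiable (by simp)) y
  have hdd : ∀ u, DifferentiableAt ℝ (fun y => fderiv ℝ ψ y u) y := fun u => ((hd u).differentiable (by simp)) y
  have hdBd : ∀ u, DifferentiableAt ℝ (fun y => fderiv ℝ B y u) y := fun u => ((hdB u).differentiable (by simp)) y
  -- `∂ᵢ ∂₂ B = ∂₂ ∂ᵢ B = ∂₂ (g ∂ᵢψ)`
  have hBi : (fun z => fderiv ℝ B z (EuclideanSpace.single i 1)) =
      fun z => g z * fderiv ℝ ψ z (EuclideanSpace.single i 1) := by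
    rcases hi with rfl | rfl
    · exact funext hB0
    · exact funext hB1
  have hmixB : fderiv ℝ (fun z => fderiv ℝ B z (EuclideanSpace.single 2 1)) y (EuclideanSpace.single i 1) =
      fderiv ℝ g y (EuclideanSpace.single 2 1) * fderiv ℝ ψ y (EuclideanSpace.single i 1) +
        g y * fderiv ℝ (fun z => fderiv ℝ ψ z (EuclideanSpace.single i 1)) y (EuclideanSpace.single 2 1) := by
    rw [SerrinBoundedHolder.fderiv_fderiv_apply_comm (hB.of_le (by norm_cast)) y
      (EuclideanSpace.single 2 1) (EuclideanSpace.single i 1), hBi, fderiv_fun_mul hgd (hdd _)]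
    simp only [_root_.add_apply, _root_.smul_apply, smul_eq_mul]
    ring
  have hmixψ : fderiv ℝ (fun z => fderiv ℝ ψ z (EuclideanSpace.single i 1)) y (EuclideanSpace.single 2 1) =
      fderiv ℝ (fun z => fderiv ℝ ψ z (EuclideanSpace.single 2 1)) y (EuclideanSpace.single i 1) :=
    SerrinBoundedHolder.fderiv_fderiv_apply_comm (hψ.of_le (by norm_cast)) y _ _
  rw [fderiv_fun_sub (hgd.fun_mul (hdd _)) (hdBd _), _root_.sub_apply, fderiv_fun_mul hgd (hdd _)]
  simp only [_root_.add_apply, _root_.smul_apply, smul_eq_mul]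
  rw [hmixB, hmixψ]
  ring

end Generic


/-! ### The class version: the Bernoulli potential of a poloidal Type-I profile -/

section Profile

open MeasureTheory Filter Topology
open Summit.NavierStokesRegularity.NavierStokesRegularity.Theorems.PoloidalWindowDoorPoloidalWindowRigidityClebsch

variable {C : ℝ} {v : ℝ → EuclideanSpace ℝ (Fin 3) → EuclideanSpace ℝ (Fin 3)}

/-- **The frozen constraint integrates to a Bernoulli potential.** Under EXACTLY the hypotheses of
`stub_nonflatLiouville` (class, poloidality along `e₂`, frozen constraint), for every `s < 0` there are smooth
`φ ψ B` with `v s = ∇φ + ψ e₂`, `curl (v s) = ∇ψ × e₂`, (E1) `Δφ + ∂₂ψ = 0`, the bracket identity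
`∂₁ψ ∂₀v₂ − ∂₀ψ ∂₁v₂ = 0`, and **`∂₀B = v₂ ∂₀ψ`, `∂₁B = v₂ ∂₁ψ`** (`∇_h B = v₂ ∇_h ψ`): on every horizontal plane
`B`, `ψ` and `v₂` are pairwise functionally dependent — the starting point of the "generic branch" analysis
`B = β(ψ; x₂, t)`, `v₂ = ∂β/∂ψ` of nsreg-p1 ROUND-8 §8 / R9-PREP §(1). (In the cell's hand analysis `B` is the
Bernoulli function `∂ₜφ + p + |v|²/2 − Δφ` up to a function of `(x₂, t)`; that identification uses the momentum
equation and is not needed for the existence statement proved here.) -/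
theorem exists_bernoulli_slice (hrate : HasTypeITimeDecay C v)
    (hcont : ContinuousOn (uncurry v) (Iio (0 : ℝ) ×ˢ univ))
    (hmild : ∀ s t : ℝ, s < t → t < 0 → ∀ x,
      v t x = UnboundedOperators.heatExtension (v s) (t - s) x - oseenDuhamel 1 s v v t x)
    (hdiv : ∀ t < 0, VectorCalculus.IsDivFree (v t))
    (hpol : ∀ s < 0, ∀ y, ⟪curl (v s) y, EuclideanSpace.single 2 1⟫_ℝ = 0)
    (hfi : ∀ s < 0, ∀ y, ⟪fderiv ℝ (v s) y (curl (v s) y), EuclideanSpace.single 2 1⟫_ℝ = 0)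
    {s : ℝ} (hs : s < 0) :
    ∃ φ ψ B : EuclideanSpace ℝ (Fin 3) → ℝ, ContDiff ℝ ∞ φ ∧ ContDiff ℝ ∞ ψ ∧ ContDiff ℝ ∞ B ∧
      (∀ y, v s y = gradient φ y + ψ y • EuclideanSpace.single 2 1) ∧
      (∀ y, curl (v s) y = cross (gradient ψ y) (EuclideanSpace.single 2 1)) ∧
      (∀ y, (Δ φ) y + fderiv ℝ ψ y (EuclideanSpace.single 2 1) = 0) ∧
      (∀ y, fderiv ℝ ψ y (EuclideanSpace.single 1 1) * fderiv ℝ (v s) y (EuclideanSpace.single 0 1) 2 -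
        fderiv ℝ ψ y (EuclideanSpace.single 0 1) * fderiv ℝ (v s) y (EuclideanSpace.single 1 1) 2 = 0) ∧
      (∀ y, fderiv ℝ B y (EuclideanSpace.single 0 1) = v s y 2 * fderiv ℝ ψ y (EuclideanSpace.single 0 1)) ∧
      (∀ y, fderiv ℝ B y (EuclideanSpace.single 1 1) = v s y 2 * fderiv ℝ ψ y (EuclideanSpace.single 1 1)) := by
  obtain ⟨φ, ψ, hφ, hψ, hvec, hcross, hE1, hbr⟩ :=
    exists_clebsch_slice_frozen hrate hcont hmild hdiv hpol hfi hs
  have hV : ContDiff ℝ ∞ (v s) := contDiff_slice hrate hcont hmild hs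
  have hg : ContDiff ℝ ∞ fun y => v s y 2 :=
    (EuclideanSpace.proj (2 : Fin 3) : EuclideanSpace ℝ (Fin 3) →L[ℝ] ℝ).contDiff.comp hV
  have hbr' : ∀ y, fderiv ℝ ψ y (EuclideanSpace.single 1 1) * fderiv ℝ (fun y => v s y 2) y (EuclideanSpace.single 0 1) -
      fderiv ℝ ψ y (EuclideanSpace.single 0 1) * fderiv ℝ (fun y => v s y 2) y (EuclideanSpace.single 1 1) = 0 := by
    intro y
    rw [fderiv_apply_coord hV, fderiv_apply_coord hV]
    exact hbr y
  obtain ⟨B, hB, hB0, hB1⟩ := exists_potential_of_bracket_eq_zero hg hψ hbr'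
  exact ⟨φ, ψ, B, hφ, hψ, hB, hvec, hcross, hE1, hbr, hB0, hB1⟩

end Profile

end Summit.NavierStokesRegularity.NavierStokesRegularity.Theorems.PoloidalWindowDoorPoloidalWindowRigidityClebschBernoulli

end
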